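import Summits.HodgeConjecture.HodgeConjecture.Theses.LinearSystemTorelli
import Literature.AlgebraicGeometry.HodgeTheory.ClassesSupportedOn
import Literature.AlgebraicGeometry.HodgeTheory.AlgebraicCyclesDefinedOverQbar
import Literature.AlgebraicGeometry.Motives.BaseChange
import Literature.AlgebraicGeometry.Motives.FamiliesVHS
import HarnessLib

/-!
# Crux-ideate sketch — stmt-HodgeConjecture-1081 `LinearSystemTorelli.MiddleDivisorSupport`
# idea `frobenius-uniform-support` (ideator 2, round 1)

Typed first lemmas of the line "support of bounded degree is a Zariski-CLOSED condition on the
arithmetic base, hence lifts from a Zariski-dense set of closed points (finite fields) to the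
generic point (ℂ) by properness of `|O(N)|` alone":

* `QbarRationalDivisorSupport` — the `r = 1` analogue of the PROVED tree fact
  `charlesSchnell2014_algebraicClasses_supportedOn_qbarClosed` (which is the case `r = p`): a class on
  the complexification of a `ℚ̄`-variety that dies off SOME complex divisor dies off the
  complexification of a `ℚ̄`-divisor (spread the divisor inside the ℚ̄-projective space `|O(N)|`,
  local topological triviality of the pair on a ℚ̄-open stratum, density of ℚ̄-points). First step of
  the line: it puts the supporting divisor on a scheme of finite type over a number ring, where it can
  be reduced modulo primes.
* `VeryGeneralSupportPropagates` — the equal-characteristic DICHOTOMY behind the line, typed on the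
  tree's family carriers: in a smooth projective family over a smooth irreducible complex base, for a
  class `A` on the total space, `{s : A|_{X_s} ∈ Nʳ Hⁱ(X_s)}` contains every point as soon as it
  contains a very general point (each bounded-degree support locus is Zariski closed — constructible
  and closed under specialisation because supports specialise inside the proper relative Hilbert
  scheme / linear system — and Baire picks one of them containing a very general point, hence all of
  `S`). For `r = p` this is the classical "algebraic at a very general point ⇒ algebraic everywhere".

The mixed-characteristic transfer itself (reduction mod 𝔭 of the Galois-saturation of `c`,
lower-semicontinuity of the support degree on `Spec O_K[1/S]`, finite-or-cofinite dichotomy) needs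
models over number rings and ℓ-adic specialisation maps, which the tree does not have yet
(definition request D1 of the card); it is stated informally on the card.
-/

noncomputable section

namespace Summit.HodgeConjecture.HodgeConjecture.Cruxes.MiddleDivisorSupport.FrobeniusUniformSupport

open CategoryTheory AlgebraicGeometry
open Literature.AlgebraicGeometry.Motives
open Literature.AlgebraicGeometry.HodgeTheory

/-- **First lemma (ℚ̄-rationality of divisor support).** For `σ : ℚ̄ →+* ℂ`, a `ℚ̄`-scheme `X₀`
with smooth projective complexification `X = X₀ ⊗_σ ℂ` of dimension `m`, and ANY class
`c ∈ Hⁱ(X(ℂ); ℂ)` (Hodge or not, rational or not): if `c` is supported in codimension `≥ 1`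
(`c ∈ supportedClasses X i 1`, i.e. `c` dies off some complex divisor), then `c` dies off the
preimage `π⁻¹ Z₀` of a Zariski-closed `Z₀ ⊆ X₀` of codimension `≥ 1` DEFINED OVER `ℚ̄`
(`π : X₀ ⊗_σ ℂ → X₀` the projection). Analogue with `r = 1` of the proved fact
`charlesSchnell2014_algebraicClasses_supportedOn_qbarClosed` (`r = p`); proof route: each summand
`ker (Hⁱ(X) → Hⁱ(X ∖ D))` with `D ∈ |O_X(N)|(ℂ) = ℙ(H⁰(X₀, O(N)))(ℂ)`; `T :=` the `ℚ̄`-Zariski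
closure of `[D]`; on the `ℚ̄`-open stratum `T° ∋ [D]` where `(X, 𝒟_t)` is topologically locally
trivial the subspace `N_{𝒟_t} ⊆ Hⁱ(X)` is locally constant; `T°(ℚ̄)` is dense in `T°(ℂ)`.
[cite: CharlesSchnell2014Notes, Cor. 11.3.16 and the Remark following it] -/
def QbarRationalDivisorSupport : Prop :=
  ∀ (σ : AlgebraicClosure ℚ →+* ℂ) ⦃m : ℕ⦄ (X₀ : SchemeOver (AlgebraicClosure ℚ)),
    IsSmoothProjective m ((baseChangeHom σ).obj X₀) →
    ∀ (i : ℕ), ∀ c ∈ supportedClasses ((baseChangeHom σ).obj X₀) i 1,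
      ∃ Z₀ : Set X₀.left, IsClosed Z₀ ∧ (∀ z ∈ Z₀, (1 : ℕ∞) ≤ Order.coheight z) ∧
        complexBetti.restrictCompl ((baseChangeHom σ).obj X₀)
          ((baseChangeHomFst σ X₀).base ⁻¹' Z₀) i c = 0

/-- **Equal-characteristic dichotomy (support propagates from a very general point).** For a
smooth projective family `f : 𝒳 ⟶ S` of relative dimension `n` over a smooth irreducible complex
base, degrees `i r`, and a class `A ∈ Hⁱ(𝒳(ℂ); ℂ)` on the total space: if the restriction
`A|_{X_s}` lies in `Nʳ Hⁱ(X_s)` for every `s` outside a countable union of proper Zariski-closed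
subsets of `S(ℂ)`, then it does so for EVERY `s`. Content: for each bound on the supporting
subschemes (degree / Hilbert polynomial) the locus `{s : A|_{X_s} supported in codim ≥ r within the
bound}` is Zariski CLOSED (constructible, and closed under specialisation since supports specialise
in the proper relative Hilbert scheme); by Baire one of these closed loci contains a very general
point, hence equals `S`. For `r = p`, `i = 2p` this is the classical closedness of algebraicity in
families; the line uses its mixed-characteristic twin over `Spec O_K[1/S]`.
[cite: CharlesSchnell2014Notes, Prop. 11.3.11 (relative Hilbert schemes, countable union of closed algebraic subsets)] -/
def VeryGeneralSupportPropagates : Prop :=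
  ∀ ⦃n : ℕ⦄ ⦃𝒳 S : SchemeOver ℂ⦄ (f : 𝒳 ⟶ S), IsSmoothProjectiveFamily f n →
    IrreducibleSpace S.left → AlgebraicGeometry.Smooth S.hom →
    ∀ (i r : ℕ) (A : complexBetti 𝒳 i) (B : ℕ → Set (ComplexPoints S)),
      (∀ k, IsZariskiClosedOnPoints S (B k) ∧ B k ≠ Set.univ) →
      (∀ s : ComplexPoints S, s ∉ (⋃ k, B k) →
        complexBetti.map (fiberι f s) i A ∈ supportedClasses (fiberOver f s) i r) →
      ∀ s : ComplexPoints S,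
        complexBetti.map (fiberι f s) i A ∈ supportedClasses (fiberOver f s) i r

/-- Sanity glue (provable now, recorded as a statement): the crux is the `i = 2p`, `r = 1`
consumer — a rational `(p,p)` class supported on the complexification of a `ℚ̄`-divisor is in
particular in `supportedClasses X (2p) 1`. [folklore] -/
theorem mem_supportedClasses_of_restrictCompl_preimage_eq_zero
    (σ : AlgebraicClosure ℚ →+* ℂ) (X₀ : SchemeOver (AlgebraicClosure ℚ)) (i : ℕ)
    (c : complexBetti ((baseChangeHom σ).obj X₀) i) (Z₀ : Set X₀.left) (hZ₀ : IsClosed Z₀)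
    (hcodim : ∀ z ∈ (baseChangeHomFst σ X₀).base ⁻¹' Z₀, (1 : ℕ∞) ≤ Order.coheight z)
    (hc : complexBetti.restrictCompl ((baseChangeHom σ).obj X₀)
      ((baseChangeHomFst σ X₀).base ⁻¹' Z₀) i c = 0) :
    c ∈ supportedClasses ((baseChangeHom σ).obj X₀) i 1 :=
  mem_supportedClasses_of_restrictCompl_eq_zero
    (hZ₀.preimage (baseChangeHomFst σ X₀).base.hom.continuous) hcodim hc

/-- The crux decl this idea is filed against, by name (audit anchor). -/
example : Prop := Summit.HodgeConjecture.HodgeConjecture.Theses.LinearSystemTorelli.MiddleDivisorSupport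

end Summit.HodgeConjecture.HodgeConjecture.Cruxes.MiddleDivisorSupport.FrobeniusUniformSupport

end
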